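import Mathlib
import Summits.Ventures.PercRepro2.OneEdge
import Summits.Ventures.PercRepro2.KPrimeReduction
import Summits.Ventures.PercRepro2.KPrimeBase
import Summits.Ventures.PercRepro2.KPrimeSure
import Summits.Ventures.PercRepro2.KPrimeEdgeSteps

/-!
# The potential `Λ = Φ_K − base` of the `v`-exploration of `(K′)`: definitions and `Λ ≥ 0 ⟹ (K′)`
(blind cell PercRepro2, mine-c g33; `conjectures/MINE-C.md` §42.8)

For an instance `p` with the weight-`1` root `V = root p ends v`, let `Ω_c` be the event «`a₁ ↮ a₂`
and every edge leaving `V` is closed» and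
  `base := (P(Ω_c, y ∈ C₁, b ∈ C₁)·P(Ω_c) − P(Ω_c, b ∈ C₁)·P(Ω_c, y ∈ C₁)) / (P(Ω_c)·P(S))`
— the value of `(K′)` at the base case of the `v`-exploration (`V` isolated, van den Berg–Kahn),
weighted by the `S`-probability that every edge leaving `V` is closed.  The potential is
`Λ := Φ_K − base`; cleared of denominators (`kprimeForm = P(S)²·D₀·Φ_K`):
  `lamForm = kprimeForm · P(Ω_c) − P(S) · D₀ · (P(Ω_c ∩ X ∩ W)·P(Ω_c) − P(Ω_c ∩ X)·P(Ω_c ∩ W))`,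
and `LamHolds p := 0 ≤ lamForm …` is «`Λ ≥ 0`» = `(K′-BASE)` (`MINE-C.md` §42.7).

* `prob_closedAll_inter`: conditioning on a set of edges being closed is the product measure with
  those edges deleted (`P(closedAll F ∩ A) = ∏_{f ∈ F} (1 − p f) · P_{p[F ↦ 0]}(A)`);
* `baseBracket_nonneg`: the bracket of `base` is `≥ 0` (van den Berg–Kahn in the deleted graph);
* `prob_Ωc_pos`: `P(Ω) > 0 ⟹ P(Ω_c) > 0` (decreasing events grow under deletion);
* **`kprimeHolds_of_lamHolds`**: `Λ ≥ 0 ⟹ (K′)`.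
-/

namespace Summit.Ventures.PercRepro2

namespace KPrime

variable {V : Type*} {E : Type*} [Fintype E] [DecidableEq E] [Fintype V] [DecidableEq V]
  {R : Type*} [Field R] [LinearOrder R] [IsStrictOrderedRing R]

/-! ## Closing a set of edges -/

section ClosedAll

/-- The event «every edge of `F` is closed». -/
def closedAll (F : Finset E) : Set (Config E) := {ω | ∀ f ∈ F, ω f = false}

variable (p : E → R)

/-- The weights with the edges of `F` deleted (set to `0`). -/
def delEdges (F : Finset E) : E → R := fun f => if f ∈ F then 0 else p f

omit [Fintype E] [Fintype V] [DecidableEq V] in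
/-- Deleting edges keeps the weights admissible. -/
lemma isProbVec_delEdges {p : E → R} (hp : IsProbVec p) (F : Finset E) : IsProbVec (delEdges p F) := by
  refine ⟨fun f => ?_, fun f => ?_⟩ <;> simp only [delEdges] <;> split_ifs
  · exact le_rfl
  · exact hp.nonneg f
  · exact zero_le_one
  · exact hp.le_one f

omit [Fintype V] [DecidableEq V] [LinearOrder R] [IsStrictOrderedRing R] in
/-- On `closedAll F` the weight factorises: the closed edges contribute `∏ (1 − p f)`, the rest is the
weight of the deleted instance. -/
lemma weight_eq_of_mem_closedAll (F : Finset E) {ω : Config E} (hω : ω ∈ closedAll F) :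
    weight p ω = (∏ f ∈ F, (1 - p f)) * weight (delEdges p F) ω := by
  rw [weight_apply, weight_apply, ← Finset.prod_filter_mul_prod_filter_not Finset.univ (· ∈ F),
    ← Finset.prod_filter_mul_prod_filter_not Finset.univ (· ∈ F)]
  have hF : Finset.univ.filter (· ∈ F) = F := by ext f; simp
  rw [hF]
  have h1 : ∏ f ∈ F, edgeFactor (p f) (ω f) = ∏ f ∈ F, (1 - p f) :=
    Finset.prod_congr rfl fun f hf => by rw [hω f hf]; simp [edgeFactor]
  have h2 : ∏ f ∈ F, edgeFactor (delEdges p F f) (ω f) = 1 :=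
    Finset.prod_eq_one fun f hf => by rw [hω f hf]; simp [edgeFactor, delEdges, hf]
  have h3 : ∏ f ∈ Finset.univ.filter (· ∉ F), edgeFactor (delEdges p F f) (ω f) =
      ∏ f ∈ Finset.univ.filter (· ∉ F), edgeFactor (p f) (ω f) :=
    Finset.prod_congr rfl fun f hf => by
      simp only [Finset.mem_filter, Finset.mem_univ, true_and] at hf
      simp [delEdges, hf]
  rw [h1, h2, h3, one_mul]

omit [Fintype V] [DecidableEq V] [LinearOrder R] [IsStrictOrderedRing R] in
/-- Off `closedAll F` the deleted instance has weight `0`. -/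
lemma weight_delEdges_eq_zero (F : Finset E) {ω : Config E} (hω : ω ∉ closedAll F) :
    weight (delEdges p F) ω = 0 := by
  simp only [closedAll, Set.mem_setOf_eq, not_forall] at hω
  obtain ⟨f, hf, hωf⟩ := hω
  rw [weight_eq_mul_edgeFactor _ ω f]
  simp only [Bool.not_eq_false] at hωf
  simp [delEdges, hf, hωf, edgeFactor]

omit [Fintype V] [DecidableEq V] [LinearOrder R] [IsStrictOrderedRing R] in
/-- **Closing a set of edges is deleting them**:
`P(closedAll F ∩ A) = ∏_{f ∈ F} (1 − p f) · P_{p[F ↦ 0]}(A)`. -/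
lemma prob_closedAll_inter (F : Finset E) (A : Set (Config E)) :
    prob p (closedAll F ∩ A) = (∏ f ∈ F, (1 - p f)) * prob (delEdges p F) A := by
  unfold prob
  rw [Finset.mul_sum]
  refine Finset.sum_congr rfl fun ω _ => ?_
  by_cases hc : ω ∈ closedAll F
  · by_cases hA : ω ∈ A
    · simp only [Set.indicator_of_mem (Set.mem_inter hc hA), Set.indicator_of_mem hA]
      exact weight_eq_of_mem_closedAll p F hc
    · have : ω ∉ closedAll F ∩ A := fun h => hA h.2
      simp [Set.indicator_of_notMem this, Set.indicator_of_notMem hA]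
  · have : ω ∉ closedAll F ∩ A := fun h => hc h.1
    rw [Set.indicator_of_notMem this]
    by_cases hA : ω ∈ A
    · rw [Set.indicator_of_mem hA, weight_delEdges_eq_zero p F hc, mul_zero]
    · rw [Set.indicator_of_notMem hA, mul_zero]

omit [Fintype V] [DecidableEq V] in
/-- Deleting an edge can only increase the probability of a decreasing event. -/
lemma prob_le_update_zero_of_isLowerSet {p : E → R} (hp : IsProbVec p) {A : Set (Config E)}
    (hA : IsLowerSet A) (e : E) : prob p A ≤ prob (Function.update p e 0) A := by
  have hmono : Monotone (Aᶜ.indicator (1 : Config E → R)) :=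
    monotone_indicator_of_isUpperSet hA.compl
  have h01 := expect_update_zero_le_expect_update_one hp hmono e
  rw [← prob_eq_expect_indicator, ← prob_eq_expect_indicator, prob_compl, prob_compl] at h01
  have hpin := prob_eq_pin p A e
  have hq0 := hp.nonneg e
  have hq1 := hp.le_one e
  nlinarith [hpin, h01, hq0, hq1]

omit [Fintype V] [DecidableEq V] in
/-- Deleting a set of edges can only increase the probability of a decreasing event. -/
lemma prob_le_delEdges_of_isLowerSet {p : E → R} (hp : IsProbVec p) {A : Set (Config E)}
    (hA : IsLowerSet A) (F : Finset E) : prob p A ≤ prob (delEdges p F) A := by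
  classical
  induction F using Finset.induction_on with
  | empty =>
    have : delEdges p ∅ = p := by funext f; simp [delEdges]
    rw [this]
  | insert e T he ih =>
    have hT : IsProbVec (delEdges p T) := isProbVec_delEdges hp T
    have heq : delEdges p (insert e T) = Function.update (delEdges p T) e 0 := by
      funext f
      by_cases hf : f = e
      · subst hf; simp [delEdges]
      · simp [delEdges, hf]
    rw [heq]
    exact ih.trans (prob_le_update_zero_of_isLowerSet hT hA e)

end ClosedAll

/-! ## The potential -/

section LamDefs

variable (p : E → R) (ends : E → Sym2 V) (a₁ a₂ b v y : V)

/-- An edge LEAVING the weight-`1` root of `v`. -/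
def Leaving (f : E) : Prop := ∃ x z, ends f = s(x, z) ∧ x ∈ root p ends v ∧ z ∉ root p ends v

open Classical in
/-- The edges leaving the root of `v`, as a finset. -/
noncomputable def leavingSet : Finset E := Finset.univ.filter (Leaving p ends v)

/-- The event «every edge leaving the root of `v` is closed». -/
def vClosed : Set (Config E) := closedAll (leavingSet p ends v)

/-- `Ω_c = Ω ∩ vClosed`. -/
def Ωc : Set (Config E) := Ω ends a₁ a₂ ∩ vClosed p ends v

/-- The bracket of `base`: `P(Ω_c ∩ X ∩ W)·P(Ω_c) − P(Ω_c ∩ X)·P(Ω_c ∩ W)`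
(`X = {b ∈ C₁}`, `W = {y ∈ C₁}`). -/
noncomputable def baseBracket : R :=
  prob p (connEvent ends a₁ b ∩ connEvent ends a₁ y ∩ Ωc p ends a₁ a₂ v) *
      prob p (Ωc p ends a₁ a₂ v) -
    prob p (connEvent ends a₁ b ∩ Ωc p ends a₁ a₂ v) *
      prob p (connEvent ends a₁ y ∩ Ωc p ends a₁ a₂ v)

/-- The cleared `Λ`-form: `kprimeForm · P(Ω_c) − P(S) · D₀ · baseBracket`
(`= P(S)²·D₀·P(Ω_c)·(Φ_K − base)`). -/
noncomputable def lamForm (N₀ D₀ : R) : R :=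
  kprimeForm ends a₁ a₂ b v y p N₀ D₀ * prob p (Ωc p ends a₁ a₂ v) -
    prob p (S ends a₁ a₂ v) * D₀ * baseBracket p ends a₁ a₂ b v y

/-- `Λ ≥ 0` for the weight vector `p` (= `(K′-BASE)`). -/
def LamHolds : Prop :=
  0 ≤ lamForm p ends a₁ a₂ b v y (prob p (connEvent ends a₁ b ∩ N ends a₁ a₂ v))
    (prob p (N ends a₁ a₂ v))

end LamDefs

section LamFacts

variable {p : E → R} {ends : E → Sym2 V} {a₁ a₂ b v y : V}

omit [DecidableEq E] [Fintype V] [DecidableEq V] [IsStrictOrderedRing R] in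
/-- `Ω_c ∩ A`, as the closed-edges event intersected with `Ω ∩ A`. -/
lemma inter_Ωc_eq (A : Set (Config E)) :
    A ∩ Ωc p ends a₁ a₂ v = vClosed p ends v ∩ (A ∩ Ω ends a₁ a₂) := by
  ext ω; simp only [Ωc, Set.mem_inter_iff]; tauto

omit [DecidableEq E] [Fintype V] [DecidableEq V] [IsStrictOrderedRing R] in
/-- `Ω_c` itself. -/
lemma Ωc_eq : Ωc p ends a₁ a₂ v = vClosed p ends v ∩ Ω ends a₁ a₂ := Set.inter_comm _ _

/-- **The base bracket is non-negative**: van den Berg–Kahn in the graph with the edges leaving the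
root of `v` deleted (`P(Ω_c ∩ A) = ∏(1 − p f) · P_{p[F ↦ 0]}(Ω ∩ A)`). -/
lemma baseBracket_nonneg (hp : IsProbVec p) : 0 ≤ baseBracket p ends a₁ a₂ b v y := by
  unfold baseBracket
  rw [inter_Ωc_eq, inter_Ωc_eq, inter_Ωc_eq, Ωc_eq]
  unfold vClosed
  rw [prob_closedAll_inter, prob_closedAll_inter, prob_closedAll_inter, prob_closedAll_inter]
  set c := ∏ f ∈ leavingSet p ends v, (1 - p f) with hc
  set q := delEdges p (leavingSet p ends v) with hq
  have hq' : IsProbVec q := isProbVec_delEdges hp _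
  have key := vdBK_pair q hq' ends a₁ b y a₂
  have hΩ : Ω ends a₁ a₂ = (connEvent ends a₁ a₂)ᶜ := by
    ext ω; simp only [mem_Ω, Set.mem_compl_iff, mem_connEvent]
  rw [← hΩ] at key
  have hc0 : 0 ≤ c := Finset.prod_nonneg fun f _ => sub_nonneg.2 (hp.le_one f)
  have hc2 : 0 ≤ c * c := mul_nonneg hc0 hc0
  nlinarith [mul_nonneg hc2 (sub_nonneg.2 key)]

omit [Fintype E] [DecidableEq E] [Fintype V] [DecidableEq V] [IsStrictOrderedRing R] in
/-- `Ω` is a decreasing event. -/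
lemma isLowerSet_Ω : IsLowerSet (Ω ends a₁ a₂) := by
  intro ω ω' hle hω
  rw [mem_Ω] at hω ⊢
  exact fun h => hω (conn_mono hle h)

omit [Fintype E] [DecidableEq E] [Fintype V] [DecidableEq V] [IsStrictOrderedRing R] in
/-- An edge leaving the root of `v` has weight `< 1`. -/
lemma lt_one_of_leaving (hp : IsProbVec p) {f : E} (hf : Leaving p ends v f) : p f < 1 := by
  obtain ⟨x, z, hends, hx, hz⟩ := hf
  exact lt_of_le_of_ne (hp.le_one f) (fun h1 => hz (mem_root_of_one p hends hx h1))

omit [Fintype V] [DecidableEq V] in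
/-- `P(Ω) > 0 ⟹ P(Ω_c) > 0`: the edges leaving the root have weight `< 1` and `Ω` is decreasing. -/
lemma prob_Ωc_pos (hp : IsProbVec p) (hΩ : 0 < prob p (Ω ends a₁ a₂)) :
    0 < prob p (Ωc p ends a₁ a₂ v) := by
  rw [Ωc_eq]
  unfold vClosed
  rw [prob_closedAll_inter]
  have hc : 0 < ∏ f ∈ leavingSet p ends v, (1 - p f) := by
    apply Finset.prod_pos
    intro f hf
    have : Leaving p ends v f := by
      classical
      simpa [leavingSet] using hf
    exact sub_pos.2 (lt_one_of_leaving hp this)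
  have hmono := prob_le_delEdges_of_isLowerSet hp (isLowerSet_Ω (ends := ends) (a₁ := a₁) (a₂ := a₂))
    (leavingSet p ends v)
  exact mul_pos hc (lt_of_lt_of_le hΩ hmono)

omit [Fintype V] in
/-- Every mass of `kprimeForm` lies in `Ω`: if `Ω` is null, the form is `0`. -/
lemma kprimeForm_eq_zero_of_prob_Ω_eq_zero (hp : IsProbVec p) (hΩ : prob p (Ω ends a₁ a₂) = 0)
    (N₀ D₀ : R) : kprimeForm ends a₁ a₂ b v y p N₀ D₀ = 0 := by
  have z : ∀ A : Set (Config E), A ⊆ Ω ends a₁ a₂ → prob p A = 0 := fun A hA =>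
    le_antisymm (hΩ ▸ prob_mono hp hA) (prob_nonneg hp A)
  have hSΩ : S ends a₁ a₂ v ⊆ Ω ends a₁ a₂ := S_subset_Ω
  unfold kprimeForm
  rw [z _ Set.inter_subset_right, z _ Set.inter_subset_right, z _ (Set.inter_subset_right.trans hSΩ),
    z _ hSΩ, z _ (cls01e_subset_S.trans hSΩ), z _ (cls01_subset_S.trans hSΩ),
    z _ Set.inter_subset_right, z _ Set.inter_subset_right]
  ring

/-- **`Λ ≥ 0` implies `(K′)`**: `kprimeForm · P(Ω_c) ≥ P(S) · D₀ · baseBracket ≥ 0`, and `P(Ω_c) > 0`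
unless `Ω` is null (when the form is `0`). -/
theorem kprimeHolds_of_lamHolds (hp : IsProbVec p) (h : LamHolds p ends a₁ a₂ b v y) :
    KPrimeHolds ends a₁ a₂ b v y p := by
  unfold LamHolds lamForm at h
  unfold KPrimeHolds
  rcases (prob_nonneg hp (Ω ends a₁ a₂)).lt_or_eq with hΩ | hΩ
  · have hOc := prob_Ωc_pos (v := v) hp hΩ
    have hB := baseBracket_nonneg (p := p) (ends := ends) (a₁ := a₁) (a₂ := a₂) (b := b) (v := v) (y := y) hp
    have hS := prob_nonneg hp (S ends a₁ a₂ v)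
    have hD := prob_nonneg hp (N ends a₁ a₂ v)
    have h2 : 0 ≤ kprimeForm ends a₁ a₂ b v y p (prob p (connEvent ends a₁ b ∩ N ends a₁ a₂ v))
        (prob p (N ends a₁ a₂ v)) * prob p (Ωc p ends a₁ a₂ v) := by
      nlinarith [mul_nonneg (mul_nonneg hS hD) hB]
    exact (mul_nonneg_iff_of_pos_right hOc).1 h2
  · rw [kprimeForm_eq_zero_of_prob_Ω_eq_zero hp hΩ.symm]

end LamFacts

end KPrime

end Summit.Ventures.PercRepro2
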